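import Summits.ResolutionOfSingularities.ResolutionOfSingularities.Theorems.FrobeniusClosingSteerFreeChainBoundPBasis
import Summits.ResolutionOfSingularities.ResolutionOfSingularities.Theorems.FrobeniusClosingSteerGeomChartTwoBasis
import HarnessLib

/-!
# Crux `Steer` (stmt-ResolutionOfSingularities-16345), chain W4.1, hGW3 assembly (e = 2 design, map v1.1 §4 step (τ)): the INTRINSIC absolute Jacobian
# colength `τ = ℓ(Ŝ ⧸ 𝒥_abs f̂)` of an ISOLATED `2`-radicand is FINITE

OURS (campaign `res-hironaka`, rung L ★L-G4, slot W4.1; seat res-L0-w41-stub-2 g6; `hGW3-ASSEMBLY-MAP.md` ac602735a6cfc835 §4). Theses-free, definition-free.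
res-L0-w41-stub-3's K1′ `IsolatedColength.length_quotient_span_jacobian_lt_top_of_isolated` gives `τ⁺ < ∞` in a Cohen FRAME with a dual 2-frame of the
coefficient field; `FreeChainBoundPBasis.span_derivation_eq_span_jacobian` + (E) `JacobianLength.length_quotient_jacobian_eq_of_ringEquiv` make it the
frame-free number `ℓ_{Ŝ}(Ŝ ⧸ (D f̂)_{D ∈ Der_ℤ Ŝ})`, which is what the e = 2 assembler compares across an étale base change. [folklore]

* `AbsJacobian.length_quotient_span_derivation_lt_top_of_isolated` — regular local `S` of characteristic `2` and dimension `n`, `S` excellent, `f` with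
  isolated `2`-radicand, a finite 2-basis `γ` of `κ(Ŝ)` with dual `ℤ`-derivations ⟹ `ℓ(Ŝ ⧸ 𝒥_abs f̂) < ∞`;
* `AbsJacobian.length_quotient_span_derivation_lt_top_of_chart` — the same for a GEOMETRIC CHART over a perfect field (2-frame supplied).
-/

noncomputable section

set_option linter.dupNamespace false

open IsLocalRing MvPowerSeries
open Literature.AlgebraicGeometry.Resolution Literature.RingTheory.MvPowerSeries Literature.FieldTheory.Separability
open Summit.ResolutionOfSingularities.ResolutionOfSingularities.Theorems.SwitchingDichotomy

namespace Summit.ResolutionOfSingularities.ResolutionOfSingularities.Theorems.SwitchingDichotomy.AbsJacobian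

/-- **`τ = ℓ(Ŝ ⧸ 𝒥_abs f̂) < ∞` for an isolated `2`-radicand** over an excellent regular local ring of characteristic `2` whose completion's residue field
carries a finite 2-basis with dual derivations. [cite: Matsumura1987, Thm. 29.7, Thm. 30.6] [folklore] -/
theorem length_quotient_span_derivation_lt_top_of_isolated {S : Type} [CommRing S] [IsRegularLocalRing S] [CharP S 2]
    (hexc : IsExcellentRing S) {n : ℕ} (hS : ringKrullDim S = n) (f : S)
    (hiso : ∀ (P : Ideal (AdjoinRoot ((Polynomial.X : Polynomial S) ^ 2 - Polynomial.C f))) [P.IsPrime],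
      (∃ Q : Ideal (AdjoinRoot ((Polynomial.X : Polynomial S) ^ 2 - Polynomial.C f)), Q.IsPrime ∧ P < Q) →
        IsRegularLocalRing (Localization.AtPrime P))
    [CharP (ResidueField (AdicCompletion (maximalIdeal S) S)) 2]
    {r : ℕ} (γ : Fin r → ResidueField (AdicCompletion (maximalIdeal S) S))
    (D : Fin r → Derivation ℤ (ResidueField (AdicCompletion (maximalIdeal S) S)) (ResidueField (AdicCompletion (maximalIdeal S) S)))
    (hB : TwoBasis.IsTwoBasis γ) (hdual : ∀ l l', D l (γ l') = if l' = l then 1 else 0) :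
    Module.length (AdicCompletion (maximalIdeal S) S) (AdicCompletion (maximalIdeal S) S ⧸
      Ideal.span (Set.range fun Dv : Derivation ℤ (AdicCompletion (maximalIdeal S) S) (AdicCompletion (maximalIdeal S) S) =>
        Dv (algebraMap S (AdicCompletion (maximalIdeal S) S) f))) < ⊤ := by
  classical
  haveI : Fact (Nat.Prime 2) := ⟨Nat.prime_two⟩
  -- a regular system of parameters indexed by `Fin n` and a Cohen frame
  have hfin : (maximalIdeal S).spanFinrank = n := by
    have h := IsRegularLocalRing.spanFinrank_maximalIdeal (R := S)
    rw [hS] at h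
    exact_mod_cast h
  obtain ⟨v₀, hv₀⟩ := exists_regularSystemOfParameters (R := S)
  let v : Fin n → S := fun i => v₀ (Fin.cast hfin.symm i)
  have hv : Ideal.span (Set.range v) = maximalIdeal S := by
    rw [← hv₀]; congr 1; ext s; constructor
    · rintro ⟨i, rfl⟩; exact ⟨_, rfl⟩
    · rintro ⟨j, rfl⟩; exact ⟨Fin.cast hfin j, by simp [v]⟩
  obtain ⟨-, frame, -, -, -, -⟩ := NestedFrames.exists_frame_with_section 2 hS v hv
  have hgen := TwoBasis.pAdjoin_eq_top_of_isTwoBasis γ hB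
  -- K1′ in the frame, then intrinsic
  have hfinK := IsolatedColength.length_quotient_span_jacobian_lt_top_of_isolated 2 hexc f hiso frame γ D hdual hgen
  have key := FreeChainBoundPBasis.span_derivation_eq_span_jacobian 2 γ D hdual hgen (frame (algebraMap S (AdicCompletion (maximalIdeal S) S) f))
  have hfin2 := (congrArg (fun J => Module.length (MvPowerSeries (Fin n) (ResidueField (AdicCompletion (maximalIdeal S) S)))
    (MvPowerSeries (Fin n) (ResidueField (AdicCompletion (maximalIdeal S) S)) ⧸ J)) key).trans_lt hfinK
  have htransport := JacobianLength.length_quotient_jacobian_eq_of_ringEquiv frame (algebraMap S (AdicCompletion (maximalIdeal S) S) f)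
  have hrange : ∀ (i₁ i₂ : Algebra ℤ (MvPowerSeries (Fin n) (ResidueField (AdicCompletion (maximalIdeal S) S))))
      (b : MvPowerSeries (Fin n) (ResidueField (AdicCompletion (maximalIdeal S) S))),
      (Set.range fun Dv : @Derivation ℤ (MvPowerSeries (Fin n) (ResidueField (AdicCompletion (maximalIdeal S) S)))
          (MvPowerSeries (Fin n) (ResidueField (AdicCompletion (maximalIdeal S) S))) _ _ _ i₁ _ _ => Dv b) =
        Set.range fun Dv : @Derivation ℤ (MvPowerSeries (Fin n) (ResidueField (AdicCompletion (maximalIdeal S) S)))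
          (MvPowerSeries (Fin n) (ResidueField (AdicCompletion (maximalIdeal S) S))) _ _ _ i₂ _ _ => Dv b := by
    intro i₁ i₂ b
    obtain rfl : i₁ = i₂ := Algebra.algebra_ext _ _ fun r => (eq_intCast _ r).trans (eq_intCast _ r).symm
    rfl
  have hK := congrArg (fun s => Module.length (MvPowerSeries (Fin n) (ResidueField (AdicCompletion (maximalIdeal S) S)))
    (MvPowerSeries (Fin n) (ResidueField (AdicCompletion (maximalIdeal S) S)) ⧸ Ideal.span s))
    (hrange (MvPowerSeries.instAlgebra) (Ring.toIntAlgebra _) (frame (algebraMap S (AdicCompletion (maximalIdeal S) S) f)))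
  exact htransport.symm.trans_lt (hK.symm.trans_lt hfin2)

/-- **`τ < ∞` for an isolated `2`-radicand on an excellent regular GEOMETRIC CHART** (the 2-frame of `κ(Ŝ)` supplied by
`GeomTwoBasis.exists_pFrame_completion_of_chart`). The e = 2 assembler's downstairs bound. [folklore] -/
theorem length_quotient_span_derivation_lt_top_of_chart (k L : Type) [Field k] [PerfectField k] [Field L] [CharP L 2] [Algebra k L]
    (A : Subalgebra k L) (Q : Ideal A) (S : Subring L) [IsLocalRing S] (hreg : IsRegularLocalRing S)
    (hA : A.FG) (hQ : Q.IsPrime) (hS : ∀ z : L, z ∈ S ↔ ∃ a b : A, b ∉ Q ∧ z = (a : L) / (b : L))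
    (hexc : IsExcellentRing S) {n : ℕ} (hSd : ringKrullDim S = n) (f : S)
    (hiso : ∀ (P : Ideal (AdjoinRoot ((Polynomial.X : Polynomial S) ^ 2 - Polynomial.C f))) [P.IsPrime],
      (∃ Q : Ideal (AdjoinRoot ((Polynomial.X : Polynomial S) ^ 2 - Polynomial.C f)), Q.IsPrime ∧ P < Q) →
        IsRegularLocalRing (Localization.AtPrime P)) :
    Module.length (AdicCompletion (maximalIdeal S) S) (AdicCompletion (maximalIdeal S) S ⧸
      Ideal.span (Set.range fun Dv : Derivation ℤ (AdicCompletion (maximalIdeal S) S) (AdicCompletion (maximalIdeal S) S) =>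
        Dv (algebraMap S (AdicCompletion (maximalIdeal S) S) f))) < ⊤ := by
  haveI := hreg
  haveI : Fact (Nat.Prime 2) := ⟨Nat.prime_two⟩
  haveI : CharP (AdicCompletion (maximalIdeal S) S) 2 := RadicandCohenFrame.charP_adicCompletion 2 S
  haveI : CharP (ResidueField (AdicCompletion (maximalIdeal S) S)) 2 := RadicandCohenFrame.charP_residueField 2
  obtain ⟨r, γ, D, hB, hdual⟩ := GeomTwoBasis.exists_pFrame_completion_of_chart k L A Q S hA hQ hS
  exact length_quotient_span_derivation_lt_top_of_isolated hexc hSd f hiso γ D hB hdual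

end Summit.ResolutionOfSingularities.ResolutionOfSingularities.Theorems.SwitchingDichotomy.AbsJacobian

end
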